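import Summits.AnomalousDissipation.AnomalousDissipation.Theorems.SolenoidalFractalHomogenisationRealisedQuasiStaticCellLawUpperSomeCell
import HarnessLib

/-!
# K2R `RealisedQuasiStaticCellLaw`, line `floquet-bloch`: the registered stub `stub_upperSome` BY NAME
# (helper; `--supports stmt-AnomalousDissipation-20446`)

Summits-side helper file (everything proved; no definitions, no named facts). `upperSome` has, literally, the signature
of the registered stub `stub_upperSome` of the lead's skeleton `K2R_floquet_bloch.r18.lean` (line `floquet-bloch` of the
DECIDING crux `RealisedQuasiStaticCellLaw`, `stmt-AnomalousDissipation-20446`): for every `δ > 0` there are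
`M₀ = 1000/δ′²`, and for `M ≥ M₀` the constants `K = 10⁴M/δ′`, `ν₀ = δ′K/(10⁹M)` (`δ′ = min δ 1`), such that for
`0 < ν < ν₀`, every sector `ℓ ≠ 0` with `‖ℓ‖⌈K/ν⌉ ≤ n`, every unit polarisation `p ⊥ ℓ` and every `T > 0` SOME weak
`A = 0` passive-vector solution around the replayed cell flow from the single mode `Re(e_ℓ)p` keeps at least the energy
fraction `(ν/K)·exp(-8π²‖ℓ‖²(1 + (1+δ)(1-4ρ/3)c₀/ν²)(ν/n²)t)` for a.e. `t ∈ (0,T)` (the matching upper law of the cell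
eddy diffusivity, realised by a Galerkin-limit solution: `upperSome_cell` + `exists_weak_singleMode_of_galerkinLowerBound`).
This is NOT a proof of Onsager's conjecture nor of anomalous dissipation, and by itself not of the crux.
-/

set_option linter.dupNamespace false

noncomputable section

namespace Summit.AnomalousDissipation.AnomalousDissipation.Theorems.SolenoidalFractalHomogenisation.RealisedQuasiStaticCellLaw

open Set MeasureTheory Filter Topology Function
open scoped InnerProductSpace
open Literature.Analysis Literature.Analysis.FunctionSpaces Literature.Analysis.FunctionSpaces.Torus
open Literature.Analysis.FluidPDE Literature.Analysis.FluidPDE.LatticeShear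

set_option maxHeartbeats 400000 in
/-- **`stub_upperSome` of line `floquet-bloch`** (the signature of the registered stub, verbatim). See the module
docstring. -/
theorem upperSome : ∀ δ > (0:ℝ), ∃ M₀ > (0:ℝ), ∀ M : ℝ, ∀ hM : 0 < M, M₀ ≤ M → ∃ ν₀ > (0:ℝ), ∃ K > (0:ℝ),
    ∀ ν, ∀ hν : ν ∈ Ioo 0 ν₀, ∀ n : ℕ, ∀ ℓ : Fin 3 → ℤ, ℓ ≠ 0 →
    ‖FunctionSpaces.Torus.latticeVec ℓ‖ * (⌈K / ν⌉₊ : ℝ) ≤ n → ∀ p : EuclideanSpace ℝ (Fin 3), ‖p‖ = 1 →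
    ⟪p, FunctionSpaces.Torus.latticeVec ℓ⟫_ℝ = 0 → ∀ T > (0:ℝ),
    ∃ w, Torus.IsWeakPassiveVectorOn 0 T (ν / (n:ℝ) ^ 2)
        (((cubatureWord.stretch M hM).stretch (1 / ν) (one_div_pos.mpr hν.1)).cell n)
        (fun x => (UnitAddTorus.mFourier ℓ x).re • p) w ∧
      ∀ᵐ t ∂(volume.restrict (Ioo 0 T)),
        (ν / K) * Real.exp (-(8 * Real.pi ^ 2 * ‖FunctionSpaces.Torus.latticeVec ℓ‖ ^ 2 *
            (1 + (1 + δ) * ((1 - 4 * cubatureWord.ramp / 3) * c0) / ν ^ 2) * ν / (n:ℝ) ^ 2) * t)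
          * ∫ x, ‖(UnitAddTorus.mFourier ℓ x).re • p‖ ^ 2 ≤ ∫ x, ‖w t x‖ ^ 2 := by
  intro δ hδ
  -- the constants
  obtain ⟨δ', hδ'⟩ : ∃ δ' : ℝ, δ' = min δ 1 := ⟨_, rfl⟩
  have hδ'0 : 0 < δ' := by rw [hδ']; exact lt_min hδ one_pos
  have hδ'1 : δ' ≤ 1 := by rw [hδ']; exact min_le_right _ _
  have hδ'δ : δ' ≤ δ := by rw [hδ']; exact min_le_left _ _
  refine ⟨1000 / δ' ^ 2, by positivity, fun M hM hM₀ => ?_⟩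
  have hMδ : 1000 ≤ δ' ^ 2 * M := by
    have := mul_le_mul_of_nonneg_left hM₀ (sq_nonneg δ')
    rwa [show δ' ^ 2 * (1000 / δ' ^ 2) = 1000 by field_simp] at this
  refine ⟨δ' * (10 ^ 4 * M / δ') / (10 ^ 9 * M), by positivity, 10 ^ 4 * M / δ', by positivity,
    fun ν hν n ℓ hℓ hn p hp1 hp T hT => ?_⟩
  obtain ⟨K, hK⟩ : ∃ K : ℝ, K = 10 ^ 4 * M / δ' := ⟨_, rfl⟩
  rw [← hK] at hn
  have hK0 : 0 < K := by rw [hK]; positivity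
  have hν0 : 0 < ν := hν.1
  have hνK : ν / K ≤ δ' / (10 ^ 9 * M) := by
    have h := hν.2.le
    rw [← hK] at h
    rw [div_le_iff₀ hK0]
    calc ν ≤ δ' * K / (10 ^ 9 * M) := h
      _ = δ' / (10 ^ 9 * M) * K := by ring
  -- the cell size
  set A : ℝ := ‖latticeVec ℓ‖ with hA
  have ha1 : 1 ≤ A := one_le_norm_latticeVec hℓ
  have hceil : K / ν ≤ (⌈K / ν⌉₊ : ℝ) := Nat.le_ceil _
  have hAK : A * (K / ν) ≤ n := le_trans (mul_le_mul_of_nonneg_left hceil (by positivity)) hn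
  have hKν : 0 < K / ν := by positivity
  have hn' : (0 : ℝ) < n := lt_of_lt_of_le (by positivity) hAK
  have hnn : 0 < n := by exact_mod_cast hn'
  have hκ : 0 < ν / (n : ℝ) ^ 2 := by positivity
  have hAKν : A * K ≤ (n : ℝ) * ν := by
    have := mul_le_mul_of_nonneg_right hAK hν0.le
    rwa [show A * (K / ν) * ν = A * K by field_simp] at this
  have hGs : 10 ^ 4 * M * (A / ((n : ℝ) * ν)) ≤ δ' := by
    have h1 : A / ((n : ℝ) * ν) ≤ 1 / K := by
      rw [div_le_div_iff₀ (by positivity) hK0]; linarith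
    have h2 : 10 ^ 4 * M * (1 / K) = δ' := by rw [hK]; field_simp
    rw [← h2]
    exact mul_le_mul_of_nonneg_left h1 (by positivity)
  have hrr : A / (n : ℝ) ≤ δ' / (10 ^ 9 * M) := by
    refine le_trans ?_ hνK
    rw [div_le_div_iff₀ hn' hK0]
    linarith
  -- the Galerkin lower bound at the cell, with `δ'`
  have hcell := upperSome_cell hδ'0 hδ'1 hM hMδ hν0 hnn hκ
    ((cubatureWord.stretch M hM).stretch (1 / ν) (one_div_pos.mpr hν.1)) rfl hℓ hGs hrr hp1 hp
  -- the target functional is below it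
  have hcW : 0 ≤ (1 - 4 * cubatureWord.ramp / 3) * c0 := by
    rw [(cubature_phase_fields 0).2.2.2]; have := c0_pos; norm_num; exact this.le
  have hE : ∫ x, ‖(UnitAddTorus.mFourier ℓ x).re • p‖ ^ 2 ≤ 1 := by
    have h := integral_norm_sq_singleMode_le ℓ p
    rw [hp1] at h
    simpa using h
  have hE0 : 0 ≤ ∫ x, ‖(UnitAddTorus.mFourier ℓ x).re • p‖ ^ 2 := integral_nonneg fun x => by positivity
  have hpre : ν / K * ∫ x, ‖(UnitAddTorus.mFourier ℓ x).re • p‖ ^ 2 ≤ 1 / 2 ^ 29 := by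
    have h1 : ν / K ≤ 1 / 2 ^ 29 := hνK.trans (by
      rw [div_le_div_iff₀ (by positivity) (by positivity)]
      have hδ2 : δ' ^ 2 ≤ 1 := by nlinarith
      have : 1000 ≤ M := by nlinarith [mul_le_mul_of_nonneg_right hδ2 hM.le]
      nlinarith)
    calc ν / K * ∫ x, ‖(UnitAddTorus.mFourier ℓ x).re • p‖ ^ 2 ≤ 1 / 2 ^ 29 * 1 :=
        mul_le_mul h1 hE hE0 (by positivity)
      _ = 1 / 2 ^ 29 := mul_one _
  have hΨ : ∀ᶠ N in atTop, ∀ t, 0 ≤ t →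
      (ν / K) * Real.exp (-(8 * Real.pi ^ 2 * A ^ 2 *
            (1 + (1 + δ) * ((1 - 4 * cubatureWord.ramp / 3) * c0) / ν ^ 2) * ν / (n:ℝ) ^ 2) * t)
          * ∫ x, ‖(UnitAddTorus.mFourier ℓ x).re • p‖ ^ 2 ≤
        ‖(pvSetup_cell ((cubatureWord.stretch M hM).stretch (1 / ν) (one_div_pos.mpr hν.1)) hnn hκ.le ℓ
            (memSobolev_one_singleMode ℓ p) (isWeaklyDivFree_singleMode ℓ hp)
            (hasZeroMean_singleMode hℓ p) (mFourierCoeff_singleMode_eq_zero_of_not_sector ℓ p n)).galerkinCoeffAt N t ℓ‖ ^ 2 +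
        ‖(pvSetup_cell ((cubatureWord.stretch M hM).stretch (1 / ν) (one_div_pos.mpr hν.1)) hnn hκ.le ℓ
            (memSobolev_one_singleMode ℓ p) (isWeaklyDivFree_singleMode ℓ hp)
            (hasZeroMean_singleMode hℓ p) (mFourierCoeff_singleMode_eq_zero_of_not_sector ℓ p n)).galerkinCoeffAt N t (-ℓ)‖ ^ 2 := by
    filter_upwards [hcell] with N hN t ht
    refine le_trans ?_ (hN t ht)
    have hexp : Real.exp (-(8 * Real.pi ^ 2 * A ^ 2 *
            (1 + (1 + δ) * ((1 - 4 * cubatureWord.ramp / 3) * c0) / ν ^ 2) * ν / (n:ℝ) ^ 2) * t) ≤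
        Real.exp (-(8 * Real.pi ^ 2 * A ^ 2 *
            (1 + (1 + δ') * ((1 - 4 * cubatureWord.ramp / 3) * c0) / ν ^ 2) * ν / (n:ℝ) ^ 2) * t) := by
      refine Real.exp_le_exp.2 ?_
      rw [neg_mul, neg_mul, neg_le_neg_iff]
      refine mul_le_mul_of_nonneg_right ?_ ht
      refine div_le_div_of_nonneg_right (mul_le_mul_of_nonneg_right ?_ hν0.le) (by positivity)
      refine mul_le_mul_of_nonneg_left ?_ (by positivity)
      have : (1 + δ') * ((1 - 4 * cubatureWord.ramp / 3) * c0) / ν ^ 2 ≤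
          (1 + δ) * ((1 - 4 * cubatureWord.ramp / 3) * c0) / ν ^ 2 :=
        div_le_div_of_nonneg_right (mul_le_mul_of_nonneg_right (by linarith) hcW) (by positivity)
      linarith
    calc ν / K * Real.exp (-(8 * Real.pi ^ 2 * A ^ 2 *
            (1 + (1 + δ) * ((1 - 4 * cubatureWord.ramp / 3) * c0) / ν ^ 2) * ν / (n:ℝ) ^ 2) * t) *
          ∫ x, ‖(UnitAddTorus.mFourier ℓ x).re • p‖ ^ 2 =
        (ν / K * ∫ x, ‖(UnitAddTorus.mFourier ℓ x).re • p‖ ^ 2) * Real.exp (-(8 * Real.pi ^ 2 * A ^ 2 *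
            (1 + (1 + δ) * ((1 - 4 * cubatureWord.ramp / 3) * c0) / ν ^ 2) * ν / (n:ℝ) ^ 2) * t) := by ring
      _ ≤ 1 / 2 ^ 29 * Real.exp (-(8 * Real.pi ^ 2 * A ^ 2 *
            (1 + (1 + δ') * ((1 - 4 * cubatureWord.ramp / 3) * c0) / ν ^ 2) * ν / (n:ℝ) ^ 2) * t) :=
        mul_le_mul hpre hexp (Real.exp_pos _).le (by positivity)
  rw [hK] at hΨ
  exact exists_weak_singleMode_of_galerkinLowerBound _ hnn hκ hℓ hp hΨ hT

end Summit.AnomalousDissipation.AnomalousDissipation.Theorems.SolenoidalFractalHomogenisation.RealisedQuasiStaticCellLaw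

end
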